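import Literature.AlgebraicGeometry.AbelianSchemes.AbelianSchemeOverCommOfReduced
import Mathlib.Data.Prod.Lex
import HarnessLib

/-!
# The structure maps of `A × A` for an abelian scheme and the index maps of the product Čech covers (F-J3 (G5-b))

Layer `Literature/AlgebraicGeometry/AbelianSchemes`, namespace `Literature.AlgebraicGeometry.AbelianSchemes.AbelianSchemeOver`.  THEOREMS ONLY
(no `def`, no instance, no notation, no named fact, no `sorry`).  Cell `hodgecm-mathlib` (D-0151 ∕ FLOOR 0), P1 sub-line F-11 ∕ F0P1b, brick F-J3
«the cup-product algebra of `Ȟ•(A, 𝒪)`», item **(G5-b)** of F0P1b-p02 (g2)'s letter `LETTER-G5-ProductCover` v0 71c6d42d (B-plan2 (g17) U236; author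
B-p20 (g15)).  Count-neutral capital (`--supports stmt-HodgeConjecture-24835`); HC_CM is proved only modulo the 7 printed citations until rung 0 closes,
and nothing here bears on it.

## The source, as printed

[MumfordAV1970] §13 (the ring structure of `H•(A, 𝒪_A)` through `m^*`, `p₁^*`, `p₂^*`, the inversion-free Hopf-algebra argument) uses, of the group
law, exactly the identities below: `m ∘ (id, e) = id = m ∘ (e, id)`, `pᵢ ∘ (id, e)`, `pᵢ ∘ (e, id)`, `m ∘ sw = m` (commutativity,
[MumfordFogartyKirwan1994] Ch. 6 §1 Cor. 6.5 (p. 117): abelian schemes are commutative), `pᵢ ∘ sw = p_{3−i}`; and the Čech computation of the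
pull-backs along these maps needs, for the product cover `W₀ = {U_i ×_k U_j}` and its refinement `W = {W₀(c) ∩ m⁻¹U_l}`, index maps `θ` with
`V(c) ⊆ f⁻¹ U(θ c)` ([Hartshorne1977] III §4, functoriality of Čech cohomology, p. 218 ff.; [GortzWedhorn2020] Prop. 3.5 (p. 70) for the preimage
bookkeeping of morphisms).

## Setting

`A : AbelianSchemeOver S` (★ `AbelianSchemes/AbelianSchemeOverBase`: `A.X : Over S` a group object of the cartesian-monoidal `Over S`), with the
structure maps of the letter: `p₁ := fst A.X A.X`, `p₂ := snd A.X A.X`, `m := μ[A.X]`, `sw := (β_ A.X A.X).hom`, `i₁ := (ρ_ A.X).inv ≫ A.X ◁ η[A.X]`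
(«`(id, e)`»), `i₂ := (λ_ A.X).inv ≫ η[A.X] ▷ A.X` («`(e, id)`»); each a morphism of `Over S`, used scheme-side through `.left`.  Covers:
`U : ι → A.X.left.Opens`, `W₀ : ι ×ₗ ι → (A.X ⊗ A.X).left.Opens` with `W₀ (i, j) = p₁⁻¹ U_i ∩ p₂⁻¹ U_j`, `W : (ι ×ₗ ι) ×ₗ ι → (A.X ⊗ A.X).left.Opens` with
`W (c, l) = W₀ c ∩ m⁻¹ U_l` (binders `hW₀`, `hW`: the covers themselves are item (G5-a)), and an index `j₀` with `η⁻¹ U_{j₀} = ⊤`.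

## Statements

* §1 the nine equalities in `Over S` (`unitLeft_comp_mul`, …, `braiding_comp_mul` — the last over a FIELD base, ★ `isCommMonObj_of_field`) and
  §2 their `.left` forms (scheme morphisms);
* §3 the admissibility `V c ≤ f⁻¹ U (θ c)` of the seven index maps `θ_{p₁} (i,j) = i`, `θ_{p₂} (i,j) = j`, `θ_{sw} (i,j) = (j,i)`,
  `θ_{i₁} i = (i, j₀)`, `θ_{i₂} i = (j₀, i)`, `θ_r (c,l) = c`, `θ_m (c,l) = l`, and the monotonicity of `θ_{p₁}`, `θ_{i₁}`, `θ_{i₂}`, `θ_r`.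

## References
* [MumfordAV1970] D. Mumford, *Abelian Varieties* (1970), §13 (the cohomology ring `H•(A, 𝒪)`).
* [MumfordFogartyKirwan1994] D. Mumford, J. Fogarty, F. Kirwan, *Geometric Invariant Theory*, 3rd ed. (1994), Ch. 6 §1 Cor. 6.5 (p. 117), Def. 6.1 (p. 115).
* [Hartshorne1977] R. Hartshorne, *Algebraic Geometry* (1977), III §4 (pp. 218–225).
* [GortzWedhorn2020] U. Görtz, T. Wedhorn, *Algebraic Geometry I*, 2nd ed. (2020), Prop. 3.5 (p. 70).
-/

noncomputable section

universe u v

open CategoryTheory CategoryTheory.Limits AlgebraicGeometry MonoidalCategory CartesianMonoidalCategory TopologicalSpace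
open scoped MonObj CategoryTheory.Obj

namespace Literature.AlgebraicGeometry.AbelianSchemes

namespace AbelianSchemeOver

/-! ### §1 The nine equalities in `Over S` -/

section OverLevel

variable {S : Scheme.{u}} (A : AbelianSchemeOver S)

/-- `m ∘ (id, e) = id`: `((ρ_ X).inv ≫ X ◁ η) ≫ μ = 𝟙` (the right unit axiom of the group object).
[cite: MumfordFogartyKirwan1994, Ch. 6 §1 Definition 6.1 (p. 115)] -/
theorem unitLeft_comp_mul : ((ρ_ A.X).inv ≫ A.X ◁ η[A.X]) ≫ μ[A.X] = 𝟙 A.X := by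
  rw [Category.assoc, MonObj.mul_one, Iso.inv_hom_id]

/-- `m ∘ (e, id) = id`: `((λ_ X).inv ≫ η ▷ X) ≫ μ = 𝟙` (the left unit axiom). [cite: MumfordFogartyKirwan1994, Ch. 6 §1 Definition 6.1 (p. 115)] -/
theorem unitRight_comp_mul : ((λ_ A.X).inv ≫ η[A.X] ▷ A.X) ≫ μ[A.X] = 𝟙 A.X := by
  rw [Category.assoc, MonObj.one_mul, Iso.inv_hom_id]

/-- `p₁ ∘ (id, e) = id`. [cite: MumfordFogartyKirwan1994, Ch. 6 §1 Definition 6.1 (p. 115)] -/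
theorem unitLeft_comp_fst : ((ρ_ A.X).inv ≫ A.X ◁ η[A.X]) ≫ fst A.X A.X = 𝟙 A.X := by
  rw [Category.assoc, whiskerLeft_fst, rightUnitor_inv_fst]

/-- `p₂ ∘ (e, id) = id`. [cite: MumfordFogartyKirwan1994, Ch. 6 §1 Definition 6.1 (p. 115)] -/
theorem unitRight_comp_snd : ((λ_ A.X).inv ≫ η[A.X] ▷ A.X) ≫ snd A.X A.X = 𝟙 A.X := by
  rw [Category.assoc, whiskerRight_snd, leftUnitor_inv_snd]

/-- `p₂ ∘ (id, e) = e ∘ (X → S)`: `((ρ_ X).inv ≫ X ◁ η) ≫ snd = toUnit X ≫ η`. [cite: MumfordFogartyKirwan1994, Ch. 6 §1 Definition 6.1 (p. 115)] -/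
theorem unitLeft_comp_snd : ((ρ_ A.X).inv ≫ A.X ◁ η[A.X]) ≫ snd A.X A.X = toUnit A.X ≫ η[A.X] := by
  rw [Category.assoc, whiskerLeft_snd, rightUnitor_inv_snd_assoc]

/-- `p₁ ∘ (e, id) = e ∘ (X → S)`: `((λ_ X).inv ≫ η ▷ X) ≫ fst = toUnit X ≫ η`. [cite: MumfordFogartyKirwan1994, Ch. 6 §1 Definition 6.1 (p. 115)] -/
theorem unitRight_comp_fst : ((λ_ A.X).inv ≫ η[A.X] ▷ A.X) ≫ fst A.X A.X = toUnit A.X ≫ η[A.X] := by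
  rw [Category.assoc, whiskerRight_fst, leftUnitor_inv_fst_assoc]

/-- `p₁ ∘ sw = p₂`. [cite: MumfordFogartyKirwan1994, Ch. 6 §1 Definition 6.1 (p. 115)] -/
theorem braiding_comp_fst : (β_ A.X A.X).hom ≫ fst A.X A.X = snd A.X A.X :=
  braiding_hom_fst _ _

/-- `p₂ ∘ sw = p₁`. [cite: MumfordFogartyKirwan1994, Ch. 6 §1 Definition 6.1 (p. 115)] -/
theorem braiding_comp_snd : (β_ A.X A.X).hom ≫ snd A.X A.X = fst A.X A.X :=
  braiding_hom_snd _ _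

/-- **`m ∘ sw = m` over a field**: an abelian scheme over `Spec K` is a COMMUTATIVE group object (★ `isCommMonObj_of_field`,
[MumfordFogartyKirwan1994] Cor. 6.5). [cite: MumfordFogartyKirwan1994, Ch. 6 §1 Corollary 6.5 (p. 117)] -/
theorem braiding_comp_mul {K : Type u} [Field K] (A : AbelianSchemeOver (Spec (.of K))) :
    (β_ A.X A.X).hom ≫ μ[A.X] = μ[A.X] := by
  haveI := A.isCommMonObj_of_field
  exact IsCommMonObj.mul_comm A.X

end OverLevel

/-! ### §2 The same as equalities of scheme morphisms (`.left`) -/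

section SchemeLevel

variable {S : Scheme.{u}} (A : AbelianSchemeOver S)

/-- `i₁ ≫ m = 𝟙` on underlying schemes. [cite: MumfordFogartyKirwan1994, Ch. 6 §1 Definition 6.1 (p. 115)] -/
theorem unitLeft_left_comp_mul_left : ((ρ_ A.X).inv ≫ A.X ◁ η[A.X]).left ≫ μ[A.X].left = 𝟙 A.X.left := by
  rw [← Over.comp_left, unitLeft_comp_mul, Over.id_left]

/-- `i₂ ≫ m = 𝟙` on underlying schemes. [cite: MumfordFogartyKirwan1994, Ch. 6 §1 Definition 6.1 (p. 115)] -/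
theorem unitRight_left_comp_mul_left : ((λ_ A.X).inv ≫ η[A.X] ▷ A.X).left ≫ μ[A.X].left = 𝟙 A.X.left := by
  rw [← Over.comp_left, unitRight_comp_mul, Over.id_left]

/-- `i₁ ≫ p₁ = 𝟙` on underlying schemes. [cite: MumfordFogartyKirwan1994, Ch. 6 §1 Definition 6.1 (p. 115)] -/
theorem unitLeft_left_comp_fst_left : ((ρ_ A.X).inv ≫ A.X ◁ η[A.X]).left ≫ (fst A.X A.X).left = 𝟙 A.X.left := by
  rw [← Over.comp_left, unitLeft_comp_fst, Over.id_left]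

/-- `i₂ ≫ p₂ = 𝟙` on underlying schemes. [cite: MumfordFogartyKirwan1994, Ch. 6 §1 Definition 6.1 (p. 115)] -/
theorem unitRight_left_comp_snd_left : ((λ_ A.X).inv ≫ η[A.X] ▷ A.X).left ≫ (snd A.X A.X).left = 𝟙 A.X.left := by
  rw [← Over.comp_left, unitRight_comp_snd, Over.id_left]

/-- `i₁ ≫ p₂ = toUnit ≫ η` on underlying schemes. [cite: MumfordFogartyKirwan1994, Ch. 6 §1 Definition 6.1 (p. 115)] -/
theorem unitLeft_left_comp_snd_left :
    ((ρ_ A.X).inv ≫ A.X ◁ η[A.X]).left ≫ (snd A.X A.X).left = (toUnit A.X).left ≫ η[A.X].left := by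
  rw [← Over.comp_left, unitLeft_comp_snd, Over.comp_left]

/-- `i₂ ≫ p₁ = toUnit ≫ η` on underlying schemes. [cite: MumfordFogartyKirwan1994, Ch. 6 §1 Definition 6.1 (p. 115)] -/
theorem unitRight_left_comp_fst_left :
    ((λ_ A.X).inv ≫ η[A.X] ▷ A.X).left ≫ (fst A.X A.X).left = (toUnit A.X).left ≫ η[A.X].left := by
  rw [← Over.comp_left, unitRight_comp_fst, Over.comp_left]

/-- `sw ≫ p₁ = p₂` on underlying schemes. [cite: MumfordFogartyKirwan1994, Ch. 6 §1 Definition 6.1 (p. 115)] -/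
theorem braiding_left_comp_fst_left : (β_ A.X A.X).hom.left ≫ (fst A.X A.X).left = (snd A.X A.X).left := by
  rw [← Over.comp_left, braiding_comp_fst]

/-- `sw ≫ p₂ = p₁` on underlying schemes. [cite: MumfordFogartyKirwan1994, Ch. 6 §1 Definition 6.1 (p. 115)] -/
theorem braiding_left_comp_snd_left : (β_ A.X A.X).hom.left ≫ (snd A.X A.X).left = (fst A.X A.X).left := by
  rw [← Over.comp_left, braiding_comp_snd]

/-- `sw ≫ m = m` on underlying schemes, over a field. [cite: MumfordFogartyKirwan1994, Ch. 6 §1 Corollary 6.5 (p. 117)] -/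
theorem braiding_left_comp_mul_left {K : Type u} [Field K] (A : AbelianSchemeOver (Spec (.of K))) :
    (β_ A.X A.X).hom.left ≫ μ[A.X].left = μ[A.X].left := by
  rw [← Over.comp_left, braiding_comp_mul]

end SchemeLevel

/-! ### §3 The index maps of the product covers and their admissibility -/

section IndexMaps

variable {S : Scheme.{u}} (A : AbelianSchemeOver S) {I : Type v}
  (U : I → A.X.left.Opens)
  (W₀ : I ×ₗ I → (A.X ⊗ A.X).left.Opens)
  (hW₀ : ∀ i j : I, W₀ (toLex (i, j)) = (fst A.X A.X).left ⁻¹ᵁ U i ⊓ (snd A.X A.X).left ⁻¹ᵁ U j)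
  (W : (I ×ₗ I) ×ₗ I → (A.X ⊗ A.X).left.Opens)
  (hW : ∀ (c : I ×ₗ I) (l : I), W (toLex (c, l)) = W₀ c ⊓ μ[A.X].left ⁻¹ᵁ U l)
  (j₀ : I) (hj₀ : η[A.X].left ⁻¹ᵁ U j₀ = ⊤)

/-- Preimages of opens along composites of scheme morphisms: `(f ≫ g)⁻¹ V = f⁻¹ (g⁻¹ V)`, read pointwise through an equation
`f ≫ g = h`. [cite: GortzWedhorn2020, Prop. 3.5 (p. 70)] -/
theorem mem_preimage_of_comp_eq {X Y Z : Scheme.{u}} {f : X ⟶ Y} {g : Y ⟶ Z} {h : X ⟶ Z} (hfg : f ≫ g = h)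
    (V : Z.Opens) (x : X) : g.base (f.base x) ∈ V ↔ x ∈ h ⁻¹ᵁ V := by
  have e : g.base (f.base x) = h.base x := by
    rw [← hfg]
    rfl
  rw [e]
  rfl

include hW₀ in
/-- **`θ_{p₁} (i, j) = i` is admissible**: `W₀ (i, j) ⊆ p₁⁻¹ U_i`. [cite: Hartshorne1977, III §4 (p. 218)] -/
theorem productCover_le_preimage_fst (c : I ×ₗ I) : W₀ c ≤ (fst A.X A.X).left ⁻¹ᵁ U (ofLex c).1 := by
  obtain ⟨i, j⟩ := c
  change W₀ (toLex (i, j)) ≤ (fst A.X A.X).left ⁻¹ᵁ U i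
  rw [hW₀]
  exact inf_le_left

include hW₀ in
/-- **`θ_{p₂} (i, j) = j` is admissible**: `W₀ (i, j) ⊆ p₂⁻¹ U_j`. [cite: Hartshorne1977, III §4 (p. 218)] -/
theorem productCover_le_preimage_snd (c : I ×ₗ I) : W₀ c ≤ (snd A.X A.X).left ⁻¹ᵁ U (ofLex c).2 := by
  obtain ⟨i, j⟩ := c
  change W₀ (toLex (i, j)) ≤ (snd A.X A.X).left ⁻¹ᵁ U j
  rw [hW₀]
  exact inf_le_right

include hW₀ in
/-- **`θ_{sw} (i, j) = (j, i)` is admissible**: `W₀ (i, j) ⊆ sw⁻¹ W₀ (j, i)` (indeed equal), since `sw ≫ p₁ = p₂`, `sw ≫ p₂ = p₁`.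
[cite: Hartshorne1977, III §4 (p. 218)] -/
theorem productCover_le_preimage_braiding (c : I ×ₗ I) :
    W₀ c ≤ (β_ A.X A.X).hom.left ⁻¹ᵁ W₀ (toLex ((ofLex c).2, (ofLex c).1)) := by
  obtain ⟨i, j⟩ := c
  change W₀ (toLex (i, j)) ≤ (β_ A.X A.X).hom.left ⁻¹ᵁ W₀ (toLex (j, i))
  rw [hW₀, hW₀]
  intro x hx
  change (β_ A.X A.X).hom.left.base x ∈ (fst A.X A.X).left ⁻¹ᵁ U j ⊓ (snd A.X A.X).left ⁻¹ᵁ U i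
  refine ⟨?_, ?_⟩
  · change (fst A.X A.X).left.base ((β_ A.X A.X).hom.left.base x) ∈ U j
    rw [mem_preimage_of_comp_eq (braiding_left_comp_fst_left A) (U j) x]
    exact hx.2
  · change (snd A.X A.X).left.base ((β_ A.X A.X).hom.left.base x) ∈ U i
    rw [mem_preimage_of_comp_eq (braiding_left_comp_snd_left A) (U i) x]
    exact hx.1

include hW₀ hj₀ in
/-- **`θ_{i₁} i = (i, j₀)` is admissible**: `U_i ⊆ i₁⁻¹ W₀ (i, j₀)`, since `i₁ ≫ p₁ = 𝟙` and `i₁ ≫ p₂ = toUnit ≫ η` with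
`η⁻¹ U_{j₀}` everything. [cite: Hartshorne1977, III §4 (p. 218)] -/
theorem le_preimage_unitLeft_productCover (i : I) : U i ≤ ((ρ_ A.X).inv ≫ A.X ◁ η[A.X]).left ⁻¹ᵁ W₀ (toLex (i, j₀)) := by
  rw [hW₀]
  intro x hx
  change ((ρ_ A.X).inv ≫ A.X ◁ η[A.X]).left.base x ∈ (fst A.X A.X).left ⁻¹ᵁ U i ⊓ (snd A.X A.X).left ⁻¹ᵁ U j₀
  refine ⟨?_, ?_⟩
  · change (fst A.X A.X).left.base (((ρ_ A.X).inv ≫ A.X ◁ η[A.X]).left.base x) ∈ U i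
    rw [mem_preimage_of_comp_eq (unitLeft_left_comp_fst_left A) (U i) x]
    exact hx
  · change (snd A.X A.X).left.base (((ρ_ A.X).inv ≫ A.X ◁ η[A.X]).left.base x) ∈ U j₀
    rw [mem_preimage_of_comp_eq (unitLeft_left_comp_snd_left A) (U j₀) x]
    change (toUnit A.X).left.base x ∈ η[A.X].left ⁻¹ᵁ U j₀
    rw [hj₀]
    trivial

include hW₀ hj₀ in
/-- **`θ_{i₂} i = (j₀, i)` is admissible**: `U_i ⊆ i₂⁻¹ W₀ (j₀, i)`. [cite: Hartshorne1977, III §4 (p. 218)] -/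
theorem le_preimage_unitRight_productCover (i : I) : U i ≤ ((λ_ A.X).inv ≫ η[A.X] ▷ A.X).left ⁻¹ᵁ W₀ (toLex (j₀, i)) := by
  rw [hW₀]
  intro x hx
  change ((λ_ A.X).inv ≫ η[A.X] ▷ A.X).left.base x ∈ (fst A.X A.X).left ⁻¹ᵁ U j₀ ⊓ (snd A.X A.X).left ⁻¹ᵁ U i
  refine ⟨?_, ?_⟩
  · change (fst A.X A.X).left.base (((λ_ A.X).inv ≫ η[A.X] ▷ A.X).left.base x) ∈ U j₀
    rw [mem_preimage_of_comp_eq (unitRight_left_comp_fst_left A) (U j₀) x]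
    change (toUnit A.X).left.base x ∈ η[A.X].left ⁻¹ᵁ U j₀
    rw [hj₀]
    trivial
  · change (snd A.X A.X).left.base (((λ_ A.X).inv ≫ η[A.X] ▷ A.X).left.base x) ∈ U i
    rw [mem_preimage_of_comp_eq (unitRight_left_comp_snd_left A) (U i) x]
    exact hx

include hW in
/-- **`θ_r (c, l) = c` is admissible for the refinement `r = 𝟙`**: `W (c, l) ⊆ W₀ c`. [cite: Hartshorne1977, III §4 (p. 218)] -/
theorem refinedCover_le_productCover (d : (I ×ₗ I) ×ₗ I) : W d ≤ (𝟙 (A.X ⊗ A.X).left) ⁻¹ᵁ W₀ (ofLex d).1 := by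
  obtain ⟨c, l⟩ := d
  change W (toLex (c, l)) ≤ W₀ c
  rw [hW]
  exact inf_le_left

include hW in
/-- **`θ_m (c, l) = l` is admissible**: `W (c, l) ⊆ m⁻¹ U_l`. [cite: Hartshorne1977, III §4 (p. 218)] -/
theorem refinedCover_le_preimage_mul (d : (I ×ₗ I) ×ₗ I) : W d ≤ μ[A.X].left ⁻¹ᵁ U (ofLex d).2 := by
  obtain ⟨c, l⟩ := d
  change W (toLex (c, l)) ≤ μ[A.X].left ⁻¹ᵁ U l
  rw [hW]
  exact inf_le_right

/-- `θ_{p₁} = fst ∘ ofLex` is monotone for the lexicographic order. [cite: Hartshorne1977, III §4 (p. 218)] -/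
theorem monotone_indexMap_fst [Preorder I] : Monotone fun c : I ×ₗ I => (ofLex c).1 :=
  Prod.Lex.monotone_fst_ofLex

/-- `θ_r = fst ∘ ofLex` on `(I ×ₗ I) ×ₗ I` is monotone. [cite: Hartshorne1977, III §4 (p. 218)] -/
theorem monotone_indexMap_refine [Preorder I] : Monotone fun d : (I ×ₗ I) ×ₗ I => (ofLex d).1 :=
  Prod.Lex.monotone_fst_ofLex

/-- `θ_{i₁} i = (i, j₀)` is monotone. [cite: Hartshorne1977, III §4 (p. 218)] -/
theorem monotone_indexMap_unitLeft [PartialOrder I] (j₀ : I) : Monotone fun i : I => toLex (i, j₀) := by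
  intro i i' h
  rcases h.lt_or_eq with hlt | rfl
  · exact (Prod.Lex.toLex_lt_toLex.mpr (Or.inl hlt)).le
  · exact le_rfl

/-- `θ_{i₂} i = (j₀, i)` is monotone. [cite: Hartshorne1977, III §4 (p. 218)] -/
theorem monotone_indexMap_unitRight [PartialOrder I] (j₀ : I) : Monotone fun i : I => toLex (j₀, i) :=
  fun _ _ h => Prod.Lex.toLex_le_toLex.mpr (Or.inr ⟨rfl, h⟩)

end IndexMaps

end AbelianSchemeOver

end Literature.AlgebraicGeometry.AbelianSchemes

end
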